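import Mathlib
import HarnessLib

/-!
# Route `RadicialJung`, crux `CleanModels` (stmt-ResolutionOfSingularities-15917), line `Sketch` rev 35, stub 6 `stub_cleanProp44` (X44c):
# A UNIFORMIZER OF THE CENTRE STAYS TRANSVERSAL TO AN UNRAMIFIED SUCCESSOR CURVE — the local core of the `Γ′`-transversality (census item (v))

Seat decomp-res-hand-2 g20 (structural hand).  Item (v) of the hand-2 g19 census (`Cruxes/CleanModels/Lines/Sketch-memo-hand2-g19-stubs-5-7.md` §2 (a)):
«the horizontal successor `Γ′` of a curve centre `Y` is served by ✓ `cleanPermissibleAt_exceptionalCurve_or_obstruction_of_sides_general` at its closed points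
(the `w`-side is always TRANSVERSAL to `Γ′` since `Γ′ ≅ Y` — not yet a kernel statement)».  In that classification a side `s` obstructs only in a CORNER, by
TANGENCY (`s ∈ (N + 𝔪²) ∖ N`) or by lying IN the curve ideal `N`; for the `w`-side `s = τ^♯ w` (`w` the parameter of `𝒪_{X,x}` along the centre `Y`, i.e. a
uniformizer of `𝒪_{Y,x} = 𝒪_{X,x}/𝓘_{Y,x}`) at a point `z ∈ Γ′` over `x`, tangency and membership are excluded as soon as `Γ′ → Y` is UNRAMIFIED at `z`
([CoP1] Lemma 4.3 (4): «`Γ′` … projecting isomorphically to `Y`»).  This file is the local algebra of that exclusion (def-free; `R, R'` local rings,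
`σ : R → R'` the stalk map, `N = 𝓘_{Y,x}`, `N' = 𝓘_{Γ′,z}`):

* `not_mem_sup_sq_of_maximalIdeal_le_sup_span` — Nakayama: in a Noetherian local ring, if `𝔪' ≤ N' + (s)` and `N' ≠ 𝔪'` (`N' ≤ 𝔪'`), then
  `s ∉ N' + 𝔪'²` (and `s ∉ N'`): a function cutting the closed point on the curve `V(N')` is transversal to it.
* `maximalIdeal_le_sup_span_of_unramified` — the hypothesis from geometry: `𝔪 ≤ N + (w)` (`w̄` a uniformizer of `R/N`), `σ N ⊆ N'` (`Γ′` maps to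
  `Y`) and `𝔪' ≤ N' + 𝔪 R'` (`Γ′ → Y` UNRAMIFIED at `z`) give `𝔪' ≤ N' + (σ w)`.
* `map_not_mem_sup_sq_of_unramified` — THE TRANSVERSALITY: under those hypotheses `σ w ∉ N' + 𝔪'²` and `σ w ∉ N'`; so in
  ✓ `…_or_obstruction_of_sides_general` at a point of `Γ′` the `w`-side is never the tangent side and never inside `N'` (it can only be one side of a corner).

What is NOT here (census, size M): the scheme-level input `𝔪_z ≤ 𝓘_{Γ′,z} + 𝔪_x 𝒪_{X′,z}` («`Γ′ → Y` is unramified / an isomorphism»), to be read off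
the tree's ✓ `Literature.….IsBlowup.exists_isRsopPart_le_primeOfSpecializes_of_isNear_curve` (whose proof builds the regular system `(π♯c_j, t − π♯a, π♯w)`
at `z` with the first two in `𝔭_{η′}`, but whose statement does not export `π♯w`).  Honest framing: OURS, elementary; nothing here proves X44c, any case of
`CleanModels`, or resolution of singularities in characteristic `p`.  Setting only: [cite: CossartPiltant2008, Lemma 4.3 (4); Prop. 4.4 (proof, p. 10)]
[cite: Matsumura1987, Thm. 2.2 (Nakayama)] [cite: Piltant2013, §2 Axiom 4].
-/

noncomputable section

set_option linter.dupNamespace false -- mandated namespace of this single-conjunct summit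

open IsLocalRing

namespace Summit.ResolutionOfSingularities.ResolutionOfSingularities.Theorems.RadicialJung.CleanModels

/-! ## §1 Nakayama: a function cutting the point on the curve is transversal to the curve -/

section Nakayama

variable {R' : Type*} [CommRing R'] [IsLocalRing R'] [IsNoetherianRing R']

/-- **`𝔪' ≤ N' + (s)`, `N' < 𝔪'` ⟹ `s ∉ N' + 𝔪'²`.**  If `s ∈ N' + 𝔪'²` then `𝔪' ≤ N' + 𝔪'·𝔪'`, and Nakayama (`𝔪'` finitely generated, inside the
Jacobson radical) gives `𝔪' ≤ N'`, i.e. `N' = 𝔪'`. [cite: Matsumura1987, Thm. 2.2] -/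
theorem not_mem_sup_sq_of_maximalIdeal_le_sup_span {N' : Ideal R'} {s : R'} (hle : maximalIdeal R' ≤ N' ⊔ Ideal.span {s})
    (hN' : N' ≤ maximalIdeal R') (hne : N' ≠ maximalIdeal R') : s ∉ N' ⊔ maximalIdeal R' ^ 2 := by
  intro hs
  apply hne (le_antisymm hN' ?_)
  -- `𝔪' ≤ N' + 𝔪' • 𝔪'`
  have h1 : maximalIdeal R' ≤ N' ⊔ maximalIdeal R' • maximalIdeal R' := by
    refine hle.trans (sup_le le_sup_left ?_)
    rw [Ideal.span_singleton_le_iff_mem, Ideal.smul_eq_mul, ← pow_two]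
    exact hs
  exact Submodule.le_of_le_smul_of_le_jacobson_bot (IsNoetherian.noetherian _) (maximalIdeal_le_jacobson ⊥) h1

/-- Under the same hypotheses `s ∉ N'` (a fortiori). [folklore] -/
theorem not_mem_of_maximalIdeal_le_sup_span {N' : Ideal R'} {s : R'} (hle : maximalIdeal R' ≤ N' ⊔ Ideal.span {s})
    (hN' : N' ≤ maximalIdeal R') (hne : N' ≠ maximalIdeal R') : s ∉ N' :=
  fun hs => not_mem_sup_sq_of_maximalIdeal_le_sup_span hle hN' hne (Ideal.mem_sup_left hs)

/-- And `s ∈ 𝔪' ∖ 𝔪'²` whenever `s ∈ 𝔪'`: `s` is a regular parameter of `R'`. [folklore] -/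
theorem not_mem_sq_of_maximalIdeal_le_sup_span {N' : Ideal R'} {s : R'} (hle : maximalIdeal R' ≤ N' ⊔ Ideal.span {s})
    (hN' : N' ≤ maximalIdeal R') (hne : N' ≠ maximalIdeal R') : s ∉ maximalIdeal R' ^ 2 :=
  fun hs => not_mem_sup_sq_of_maximalIdeal_le_sup_span hle hN' hne (Ideal.mem_sup_right hs)

end Nakayama

/-! ## §2 The hypothesis from geometry: an unramified successor curve -/

section Unramified

variable {R R' : Type*} [CommRing R] [IsLocalRing R] [CommRing R'] [IsLocalRing R'] (σ : R →+* R') {N : Ideal R} {N' : Ideal R'} {w : R}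

/-- **`𝔪' ≤ N' + (σ w)`** from: `𝔪 ≤ N + (w)` (`w̄` generates the maximal ideal of `R/N`, e.g. `(c, w)` a regular system of parameters with `(c) = N`),
`σ N ⊆ N'` (the successor curve maps to the centre) and `𝔪' ≤ N' + 𝔪 R'` (the successor curve is UNRAMIFIED over the centre at the point).
[cite: CossartPiltant2008, Lemma 4.3 (4)] -/
theorem maximalIdeal_le_sup_span_of_unramified (hw : maximalIdeal R ≤ N ⊔ Ideal.span {w}) (hN : N.map σ ≤ N')
    (hunr : maximalIdeal R' ≤ N' ⊔ (maximalIdeal R).map σ) : maximalIdeal R' ≤ N' ⊔ Ideal.span {σ w} := by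
  refine hunr.trans (sup_le le_sup_left ?_)
  have h1 : (maximalIdeal R).map σ ≤ (N ⊔ Ideal.span {w}).map σ := Ideal.map_mono hw
  rw [Ideal.map_sup, Ideal.map_span, Set.image_singleton] at h1
  exact h1.trans (sup_le_sup_right hN _)

variable [IsNoetherianRing R']

/-- **THE TRANSVERSALITY OF THE `w`-SIDE**: with `𝔪 ≤ N + (w)`, `σ N ⊆ N'`, `Γ′ → Y` unramified at the point (`𝔪' ≤ N' + 𝔪 R'`) and `N' < 𝔪'` (the
successor is a curve, not the point), the image `σ w` is transversal to the successor curve: `σ w ∉ N' + 𝔪'²`, and `σ w ∉ N'`.  In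
✓ `cleanPermissibleAt_exceptionalCurve_or_obstruction_of_sides_general` at such a point the `w`-side is therefore neither the TANGENT side nor inside the curve
ideal. [cite: CossartPiltant2008, Lemma 4.3 (4); Prop. 4.4 (proof, p. 10)] [cite: Piltant2013, §2 Axiom 4] -/
theorem map_not_mem_sup_sq_of_unramified (hw : maximalIdeal R ≤ N ⊔ Ideal.span {w}) (hN : N.map σ ≤ N')
    (hunr : maximalIdeal R' ≤ N' ⊔ (maximalIdeal R).map σ) (hN' : N' ≤ maximalIdeal R') (hne : N' ≠ maximalIdeal R') :
    σ w ∉ N' ⊔ maximalIdeal R' ^ 2 ∧ σ w ∉ N' :=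
  have hle := maximalIdeal_le_sup_span_of_unramified σ hw hN hunr
  ⟨not_mem_sup_sq_of_maximalIdeal_le_sup_span hle hN' hne, not_mem_of_maximalIdeal_le_sup_span hle hN' hne⟩

/-- The same with the centre ideal given by generators: `N = (c)`, `(c, w)` spanning `𝔪` (a regular system of parameters adapted to the centre, as in
✓ `…_of_sides_general` with `l = 1`), `σ c_k ∈ N'` for all `k`. [cite: CossartPiltant2008, Lemma 4.3 (4)] -/
theorem map_not_mem_sup_sq_of_unramified_of_span {n : ℕ} {c : Fin n → R}
    (hcw : Ideal.span (Set.range c ∪ {w}) = maximalIdeal R) (hc : ∀ k, σ (c k) ∈ N')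
    (hunr : maximalIdeal R' ≤ N' ⊔ (maximalIdeal R).map σ) (hN' : N' ≤ maximalIdeal R') (hne : N' ≠ maximalIdeal R') :
    σ w ∉ N' ⊔ maximalIdeal R' ^ 2 ∧ σ w ∉ N' := by
  refine map_not_mem_sup_sq_of_unramified σ (N := Ideal.span (Set.range c)) (le_of_eq ?_) ?_ hunr hN' hne
  · rw [← hcw, Ideal.span_union]
  · rw [Ideal.map_span, Ideal.span_le]
    rintro _ ⟨_, ⟨k, rfl⟩, rfl⟩
    exact hc k

end Unramified

end Summit.ResolutionOfSingularities.ResolutionOfSingularities.Theorems.RadicialJung.CleanModels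

end
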